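import Literature.MathematicalPhysics.QuantumFieldTheory.Federbush1986.ModeAnalyticityConeLimit
import Literature.MathematicalPhysics.QuantumFieldTheory.Federbush1986.ModeAnalyticityBracketSplit
import Literature.Analysis.Complex.AbhyankarJungReal

/-!
# Federbush–Williamson, *A phase cell approach to Yang–Mills theory. II. Analysis of a mode* (J. Math. Phys. **28**
# (1987) 1416–1419) [FederbushWilliamson1987PhaseCellII] — Theorem 3.1 p. 1417 is FALSE AS TYPED: the mode
# `A^N_1(p)` of (2.4) has NO analytic continuation to any neighbourhood of `p = 0`

statement-level skeleton of published theorems with citation tags; proofs where landed; nothing here is a claim about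
the Yang–Mills mass gap

PDF held: Deep-Blue scan `run/shared/lean/pub/pub-balaban/t4/b2b-balaban-t4-lit2/pdf/fedwill1987-jmp28-II.pdf`, page
renders `…/b2b-balaban-t4-lit2/g7/fw1987II/fedwill1987-jmp28-II-p001…p004-x2.png` (read as images this session).

WHAT IS DECIDED (cell `lit-balaban`, Phase-2 proof seat p04 gen 5, SKELETON row **F2.Thm3.1**; HOME
`run/shared/lean/pub/lit-balaban/lit-balaban-p04/`; GAPS.md §G-F2-01).  r17's typed reading
`ModeAnalyticity.Theorem31 s i` of **Theorem 3.1** («There is an ε₀ > 0 such that in the domain 𝒟_L … A^N_i(p) is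
analytic», TYPED as: some `g` analytic at every point of `𝒟_L(ε₀) ⊇ {‖p‖ < ε₀ ∧ 1/2}` agrees with the formula (2.4) for
`A^N_i` at the real generic momenta) is REFUTED for the component `i = 1` (index `0`) and EVERY `s`:
**`not_theorem31 (s) : ¬ Theorem31 s 0`**; likewise `not_theorem32`, `not_theorem33` (their `𝒟_G ⊇ 𝒟_L`) and
`not_theorems31to33` (r17's package F2.Thms).  The kernel argument (`no_holomorphic_extension`): if `g` is holomorphic
on a ball `‖p‖ < ρ ≤ 1/2` and agrees with `A^N_1` at its real generic points, then the holomorphic combination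
`H_g = Φ·(N·e₁·(1+p²)^s + p₁²(1+ĝ)) − p²·r₀·(1+ĝ)·e₁·(1+p²)^s·g` (all factors holomorphic on the ball:
`ModeAnalyticityBracketSplit`) vanishes at the real points of the small ball around `(ρ/4,ρ/4,ρ/4,ρ/4)` by the cleared
form (★) of (5.5) (`main_identity`), hence on that ball by the totally real identity principle
(`AbhyankarJung.eqOn_zero_of_forall_real`), hence on the whole ball (identity theorem); but on the complex light cone
`p = t(1,i,0,0)` one has `p² = 0`, `e_j = 1`, `N = −t²`, `ĝ = t²(D₂ − D₁)` so `H_g(tv) = Φ(tv)·t⁴·(D₂ − D₁)(tv)` with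
`Φ(tv) ≠ 0`, forcing `(D₂ − D₁)(tv)/t² = 0` for `0 < |t| < ρ` — contradicting **`tendsto_cone`**
(`(D₂ − D₁)(tv)/t² → ℓ`) and **`ell_pos`** (`ℓ = 2Σ_{N≠0}(2πN)⁻⁴ = 1/360 > 0`) of `ModeAnalyticityConeLimit`.
WHERE THE PRINT FAILS (GAPS.md §G-F2-01): (6.12) claims `|g| ≤ c|p|⁶` for the `g` of (6.11); by (6.14) and
(6.5)–(6.7) one only gets `g = c((p²)² … ) + Σ_k p_k²Σ_{j≠k}p²D_j + O(|p|⁶)`, whose `t⁴`-coefficient on the cone is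
`ℓ ≠ 0`; equivalently the claimed regularity (6.2) of `D_j − D_i` contradicts (6.5).  So `A^N_1 = Φ·F/(p²r₀)` has a
POLE along the light cone through `0 ∈ 𝒟_L`, and no `ε₀` works.  (The weaker statements that survive — analyticity
off the cone, or of `p²·A^N` near 0 — are not what is printed.)  D-0026: no named fact; r17's `def`s are untouched.
-/

noncomputable section

namespace Literature.MathematicalPhysics.QuantumFieldTheory.Federbush1986

namespace ModeAnalyticityThm31Refutation

open ModeAnalyticity ModeAnalyticityLatticeSums ModeAnalyticityConeLimit ModeAnalyticityBracketSplit
  Complex Filter Topology Finset Metric Set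
open scoped BigOperators Real

/-! ## The holomorphic combination `H_g` -/

/-- (plumbing) `H_g(p) = Φ·(N·e₁·(1+p²)^s + p₁²(1+ĝ)) − p²·r₀·(1+ĝ)·e₁·(1+p²)^s·g(p)`: (5.5) cleared of denominators,
with the candidate extension `g` in place of `A^N_1`. [cite: FederbushWilliamson1987PhaseCellII, (5.5) p. 1418] -/
def H (s : ℕ) (g : Momentum → ℂ) (p : Momentum) : ℂ :=
  Phi p * (Nn p * E 0 p * (1 + csq p) ^ s + (p 0) ^ 2 * (1 + ghat p))
    - csq p * r0 p * (1 + ghat p) * E 0 p * (1 + csq p) ^ s * g p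

/-- (plumbing) the balls `‖p‖ < ρ`, `ρ ≤ 1/2`, lie in the ball `U` of `ModeAnalyticityLatticeSums`.
[cite: FederbushWilliamson1987PhaseCellII, §V p. 1418] -/
theorem ball_subset_U {ρ : ℝ} (hρ : ρ ≤ 1 / 2) : ball (0 : Momentum) ρ ⊆ U := by
  unfold U; exact ball_subset_ball hρ

/-- (plumbing) the balls `‖p‖ < ρ ≤ 1/2` lie in `𝒟_L(ε₀)` as soon as `ρ ≤ ε₀` (sup norm; `1/2 < π`).
[cite: FederbushWilliamson1987PhaseCellII, (3.2) p. 1417] -/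
theorem ball_subset_DL {ρ ε₀ : ℝ} (hρ : 0 < ρ) (hρ2 : ρ ≤ 1 / 2) (hρε : ρ ≤ ε₀) : ball (0 : Momentum) ρ ⊆ DL ε₀ := by
  intro p hp j
  rw [mem_ball_zero_iff, pi_norm_lt_iff hρ] at hp
  have h1 : |(p j).re| < ρ := (abs_re_le_norm (p j)).trans_lt (hp j)
  have h2 : |(p j).im| < ρ := (abs_im_le_norm (p j)).trans_lt (hp j)
  rw [abs_lt] at h1
  refine ⟨?_, ?_, h2.trans_le hρε⟩ <;> linarith [Real.pi_gt_three, h1.1, h1.2]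

/-- (plumbing) the balls `‖p‖ < ρ` lie in `𝒟_G(ε₀)` as soon as `ρ ≤ ε₀`. [cite: FederbushWilliamson1987PhaseCellII,
(3.3) p. 1417] -/
theorem ball_subset_DG {ρ ε₀ : ℝ} (hρ : 0 < ρ) (hρε : ρ ≤ ε₀) : ball (0 : Momentum) ρ ⊆ DG ε₀ := by
  intro p hp j
  rw [mem_ball_zero_iff, pi_norm_lt_iff hρ] at hp
  exact ((abs_im_le_norm (p j)).trans_lt (hp j)).trans_le hρε

/-- `H_g` is holomorphic on the ball when `g` is. [cite: FederbushWilliamson1987PhaseCellII, (6.1) p. 1418] -/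
theorem differentiableOn_H (s : ℕ) {g : Momentum → ℂ} {ρ : ℝ} (hρ : ρ ≤ 1 / 2)
    (hg : DifferentiableOn ℂ g (ball 0 ρ)) : DifferentiableOn ℂ (H s g) (ball 0 ρ) := by
  have hB := ball_subset_U hρ
  have hPhi : DifferentiableOn ℂ Phi (ball (0 : Momentum) ρ) := fun p _ =>
    (analyticAt_Phi p).differentiableAt.differentiableWithinAt
  have hr0 : DifferentiableOn ℂ r0 (ball (0 : Momentum) ρ) := fun p _ =>
    (analyticAt_r0 p).differentiableAt.differentiableWithinAt
  have hE := (differentiableOn_E 0).mono hB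
  have hN := differentiableOn_Nn.mono hB
  have hgh := differentiableOn_ghat.mono hB
  have hc : DifferentiableOn ℂ csq (ball (0 : Momentum) ρ) := differentiable_csq.differentiableOn
  have h0 : DifferentiableOn ℂ (fun p : Momentum => (p 0) ^ 2) (ball (0 : Momentum) ρ) :=
    ((differentiable_apply 0).pow 2).differentiableOn
  unfold H
  exact (hPhi.mul (((hN.mul hE).mul ((hc.const_add 1).pow s)).add (h0.mul (hgh.const_add 1)))).sub
    (((((hc.mul hr0).mul (hgh.const_add 1)).mul hE).mul ((hc.const_add 1).pow s)).mul hg)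

/-- At a point of the ball where (★) applies and `g(p) = A^N_1(p)`, `H_g(p) = 0`.
[cite: FederbushWilliamson1987PhaseCellII, (5.5) p. 1418] -/
theorem H_eq_zero {s : ℕ} {g : Momentum → ℂ} {p : Momentum} (hU : p ∈ U) (hp : ∀ i, p i ≠ 0) (hc : csq p ≠ 0)
    (hf : exp (I * p 0) ≠ 1) (h1 : 1 + csq p ≠ 0) (hg : g p = AN s 0 p) : H s g p = 0 := by
  unfold H
  rw [hg, ← main_identity s hU hp hc hf h1, sub_self]

/-! ## The real points used: a small ball around `(ρ/4, ρ/4, ρ/4, ρ/4)` -/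

/-- (plumbing) the real base point `a = (ρ/4, ρ/4, ρ/4, ρ/4)`. [cite: FederbushWilliamson1987PhaseCellII, §II p. 1417] -/
def a (ρ : ℝ) : Momentum := fun _ => ((ρ / 4 : ℝ) : ℂ)

/-- (plumbing) `‖a‖ = ρ/4` for `ρ > 0`. [cite: FederbushWilliamson1987PhaseCellII, §II p. 1417] -/
theorem norm_a {ρ : ℝ} (hρ : 0 < ρ) : ‖a ρ‖ = ρ / 4 := by
  unfold a
  rw [pi_norm_const, Complex.norm_real, Real.norm_eq_abs, abs_of_pos (by positivity)]

/-- (plumbing) the small ball `‖p − a‖ < ρ/8` lies in the ball `‖p‖ < ρ`. [cite: FederbushWilliamson1987PhaseCellII,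
§II p. 1417] -/
theorem ball_a_subset {ρ : ℝ} (hρ : 0 < ρ) : ball (a ρ) (ρ / 8) ⊆ ball 0 ρ := by
  intro p hp
  rw [mem_ball, dist_eq_norm] at hp
  rw [mem_ball_zero_iff]
  have h1 : ‖p‖ ≤ ‖p - a ρ‖ + ‖a ρ‖ := by
    calc ‖p‖ = ‖(p - a ρ) + a ρ‖ := by rw [sub_add_cancel]
      _ ≤ ‖p - a ρ‖ + ‖a ρ‖ := norm_add_le _ _
  rw [norm_a hρ] at h1
  linarith

/-- (plumbing) the real points of the small ball have coordinates in `(ρ/8, 3ρ/8)`.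
[cite: FederbushWilliamson1987PhaseCellII, §II p. 1417] -/
theorem real_coord_bounds {ρ : ℝ} {y : Fin 4 → ℝ} (hy : (fun i => (y i : ℂ)) ∈ ball (a ρ) (ρ / 8)) (j : Fin 4) :
    ρ / 8 < y j ∧ y j < 3 * ρ / 8 := by
  rw [mem_ball, dist_eq_norm] at hy
  have h := (norm_le_pi_norm ((fun i => (y i : ℂ)) - a ρ) j).trans_lt hy
  simp only [Pi.sub_apply, a] at h
  rw [← Complex.ofReal_sub, Complex.norm_real, Real.norm_eq_abs, abs_lt] at h
  constructor <;> linarith [h.1, h.2]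

/-- (plumbing) `p²` at a real point is the real sum of squares. [cite: FederbushWilliamson1987PhaseCellII, (1.4)
p. 1416] -/
theorem csq_ofReal (y : Fin 4 → ℝ) : csq (fun i => (y i : ℂ)) = ((∑ j, y j ^ 2 : ℝ) : ℂ) := by
  unfold csq; push_cast; rfl

/-- The real points `y` of the small ball are real generic momenta at which (★) applies: all `y_j ∈ (ρ/8, 3ρ/8)`, so
`y_j ≠ 0`, `−π < y_j ≤ π`, `p² = Σy_j² > 0`, `e^{iy₁} ≠ 1`, `1 + p² ≠ 0`. [cite: FederbushWilliamson1987PhaseCellII,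
§I–§II p. 1416–1417] -/
theorem real_point {ρ : ℝ} (hρ2 : ρ ≤ 1 / 2) {y : Fin 4 → ℝ}
    (hy : (fun i => (y i : ℂ)) ∈ ball (a ρ) (ρ / 8)) :
    (fun i => (y i : ℂ)) ∈ realGeneric ∧ (∀ i, (y i : ℂ) ≠ 0) ∧ csq (fun i => (y i : ℂ)) ≠ 0 ∧
      exp (I * (y 0 : ℂ)) ≠ 1 ∧ 1 + csq (fun i => (y i : ℂ)) ≠ 0 := by
  have hb := real_coord_bounds hy
  have hρ : 0 < ρ := by linarith [(hb 0).1, (hb 0).2]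
  have hpos : ∀ j, 0 < y j := fun j => by linarith [(hb j).1]
  have hlt : ∀ j, y j < 1 := fun j => by linarith [(hb j).2]
  have hne : ∀ i, (y i : ℂ) ≠ 0 := fun i => ofReal_ne_zero.mpr (hpos i).ne'
  have hsum : 0 < ∑ j, y j ^ 2 := Finset.sum_pos (fun j _ => pow_pos (hpos j) 2) Finset.univ_nonempty
  have hc := csq_ofReal y
  refine ⟨?_, hne, ?_, ?_, ?_⟩
  · simp only [realGeneric, Set.mem_setOf_eq]
    intro j
    refine ⟨ofReal_im _, hne j, ?_, ?_⟩
    · rw [ofReal_re]; linarith [Real.pi_pos, hpos j]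
    · rw [ofReal_re]; linarith [Real.pi_gt_three, hlt j]
  · rw [hc]; exact ofReal_ne_zero.mpr hsum.ne'
  · intro h1
    have hn : ‖(y 0 : ℂ)‖ < 1 := by rw [Complex.norm_real, Real.norm_eq_abs, abs_of_pos (hpos 0)]; exact hlt 0
    have := phiP_ne_zero hn
    rw [phiP_of_ne (hne 0), h1, sub_self, zero_div] at this
    exact this rfl
  · rw [hc]
    have : (1 + ∑ j, y j ^ 2 : ℝ) ≠ 0 := by positivity
    exact_mod_cast this

/-! ## `H_g` on the light cone -/

/-- (plumbing) `t·v` lies in the ball `‖p‖ < ρ` for `|t| < ρ`. [cite: FederbushWilliamson1987PhaseCellII, §II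
p. 1417] -/
theorem pv_mem_ball {ρ t : ℝ} (hρ : 0 < ρ) (ht : |t| < ρ) : pv t ∈ ball (0 : Momentum) ρ := by
  rw [mem_ball_zero_iff, pi_norm_lt_iff hρ]
  exact fun i => (norm_pv_apply_le t i).trans_lt ht

/-- **`H_g` on the cone**: at `p = t(1,i,0,0)` one has `p² = 0`, `e_j = 1`, `N = −t²`, `ĝ = t²(D₂ − D₁)`, so
`H_g(tv) = Φ(tv)·t⁴·(D₂ − D₁)(tv)` — independently of `g` and `s`. [cite: FederbushWilliamson1987PhaseCellII, (5.5),
(6.14) p. 1418] -/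
theorem H_pv (s : ℕ) (g : Momentum → ℂ) (t : ℝ) :
    H s g (pv t) = Phi (pv t) * (t : ℂ) ^ 4 * (D 1 (pv t) - D 0 (pv t)) := by
  unfold H Nn ghat Q0 Q1 Q2 Q3 E
  simp only [csq_pv, pv_zero, pv_one, pv_two, pv_three, zero_mul, add_zero, one_pow, mul_one, sub_zero]
  linear_combination Phi (pv t) * ((t : ℂ) ^ 2 + (t : ℂ) ^ 4 * (D 0 (pv t) + D 2 (pv t) + D 3 (pv t))) * I_sq

/-- `Φ(tv) ≠ 0` for `|t| < 1`: `Φ(tv) = (i/(2π)²)(−e^{−it})·φ₋(it)·φ₋(0)²` with `φ₋(0) = −i` and `φ₋(it) ≠ 0`.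
[cite: FederbushWilliamson1987PhaseCellII, (5.1)–(5.2) p. 1417–1418] -/
theorem Phi_pv_ne_zero {t : ℝ} (ht : |t| < 1) : Phi (pv t) ≠ 0 := by
  unfold Phi
  simp only [pv_zero, pv_one, pv_two, pv_three, phiM_zero]
  have h1 : phiM ((t : ℂ) * I) ≠ 0 := phiM_ne_zero (by simpa using ht)
  have hπ : (2 * (π : ℂ)) ^ 2 ≠ 0 := pow_ne_zero _ (mul_ne_zero two_ne_zero (ofReal_ne_zero.mpr Real.pi_ne_zero))
  exact mul_ne_zero (mul_ne_zero (div_ne_zero I_ne_zero hπ) (neg_ne_zero.mpr (exp_ne_zero _)))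
    (mul_ne_zero (mul_ne_zero h1 (neg_ne_zero.mpr I_ne_zero)) (neg_ne_zero.mpr I_ne_zero))

/-- (plumbing) the punctured neighbourhood `0 < |t| < ρ`. [cite: FederbushWilliamson1987PhaseCellII, §V p. 1418] -/
theorem eventually_lt {ρ : ℝ} (hρ : 0 < ρ) : ∀ᶠ t : ℝ in 𝓝[≠] 0, t ≠ 0 ∧ |t| < ρ := by
  have h1 : ∀ᶠ t : ℝ in 𝓝[≠] 0, t ≠ 0 := eventually_mem_nhdsWithin
  have h2 : ∀ᶠ t : ℝ in 𝓝[≠] 0, |t| < ρ := by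
    have : ∀ᶠ t : ℝ in 𝓝 0, |t| < ρ := by
      have := Metric.ball_mem_nhds (0 : ℝ) hρ
      filter_upwards [this] with t ht
      simpa [Real.dist_eq] using ht
    exact this.filter_mono nhdsWithin_le_nhds
  exact h1.and h2

/-! ## The refutation -/

/-- **Core of the refutation.** No function holomorphic on a ball `‖p‖ < ρ` (`0 < ρ ≤ 1/2`) agrees with the typed mode
`A^N_1 = ModeAnalyticity.AN s 0` at the real generic momenta of that ball: `A^N_1` has a pole along the complex light
cone `p² = 0` through `p = 0`. [cite: FederbushWilliamson1987PhaseCellII, Theorem 3.1 p. 1417, (5.5), (6.11)–(6.14)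
p. 1418] -/
theorem no_holomorphic_extension (s : ℕ) {ρ : ℝ} (hρ : 0 < ρ) (hρ2 : ρ ≤ 1 / 2) {g : Momentum → ℂ}
    (hg : DifferentiableOn ℂ g (ball 0 ρ))
    (hagree : ∀ p ∈ realGeneric, p ∈ ball (0 : Momentum) ρ → g p = AN s 0 p) : False := by
  have hBU : ball (0 : Momentum) ρ ⊆ U := ball_subset_U hρ2
  have hH : DifferentiableOn ℂ (H s g) (ball 0 ρ) := differentiableOn_H s hρ2 hg
  have hWB : ball (a ρ) (ρ / 8) ⊆ ball 0 ρ := ball_a_subset hρ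
  have haW : a ρ ∈ ball (a ρ) (ρ / 8) := mem_ball_self (by positivity)
  -- Step 1: `H_g` vanishes at the real points of the small ball, hence on it (totally real identity principle)
  have hreal : ∀ y : Fin 4 → ℝ, (fun i => (y i : ℂ)) ∈ ball (a ρ) (ρ / 8) →
      H s g (fun i => (y i : ℂ)) = 0 := by
    intro y hy
    obtain ⟨hrg, hne, hc, hf, h1⟩ := real_point hρ2 hy
    exact H_eq_zero (hBU (hWB hy)) hne hc hf h1 (hagree _ hrg (hWB hy))
  have haW' : (fun i => (((fun _ => ρ / 4) : Fin 4 → ℝ) i : ℂ)) ∈ ball (a ρ) (ρ / 8) := haW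
  have hW0 : EqOn (H s g) 0 (ball (a ρ) (ρ / 8)) :=
    Literature.Analysis.Complex.AbhyankarJung.eqOn_zero_of_forall_real isOpen_ball
      (convex_ball _ _).isPreconnected (hH.mono hWB) hreal haW'
  -- Step 2: hence on the whole ball (identity theorem)
  have hHan : AnalyticOnNhd ℂ (H s g) (ball 0 ρ) :=
    Literature.Analysis.Complex.SCV.analyticOnNhd_of_differentiableOn hH isOpen_ball
  have hev : H s g =ᶠ[𝓝 (a ρ)] 0 :=
    Filter.eventuallyEq_of_mem (isOpen_ball.mem_nhds haW) hW0
  have hB0 : EqOn (H s g) 0 (ball 0 ρ) :=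
    hHan.eqOn_zero_of_preconnected_of_eventuallyEq_zero (convex_ball _ _).isPreconnected (hWB haW) hev
  -- Step 3: on the light cone this forces `(D₂ − D₁)(tv)/t² = 0` for `0 < |t| < ρ`
  have hcone : ∀ t : ℝ, t ≠ 0 → |t| < ρ → (D 1 (pv t) - D 0 (pv t)) / (t : ℂ) ^ 2 = 0 := by
    intro t ht0 ht
    have h := hB0 (pv_mem_ball hρ ht)
    rw [Pi.zero_apply, H_pv] at h
    have hPhi : Phi (pv t) ≠ 0 := Phi_pv_ne_zero (by linarith)
    have ht4 : (t : ℂ) ^ 4 ≠ 0 := pow_ne_zero _ (ofReal_ne_zero.mpr ht0)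
    have hD : D 1 (pv t) - D 0 (pv t) = 0 := by
      rcases mul_eq_zero.mp h with h' | h'
      · exact absurd h' (mul_ne_zero hPhi ht4)
      · exact h'
    rw [hD, zero_div]
  -- Step 4: but the quotient tends to `ℓ ≠ 0`
  have hlim0 : Tendsto (fun t : ℝ => (D 1 (pv t) - D 0 (pv t)) / (t : ℂ) ^ 2) (𝓝[≠] 0) (𝓝 0) := by
    refine tendsto_const_nhds.congr' ?_
    filter_upwards [eventually_lt hρ] with t ht
    exact (hcone t ht.1 ht.2).symm
  exact ell_ne_zero (tendsto_nhds_unique tendsto_cone hlim0)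

/-- **Theorem 3.1 of [FederbushWilliamson1987PhaseCellII] is false as typed** (component `i = 1`, every `s`): there is
no `ε₀ > 0` and no `g` analytic on `𝒟_L(ε₀)` agreeing with `A^N_1` at the real generic momenta — `𝒟_L(ε₀)` contains
the ball `‖p‖ < min(ε₀, 1/2)` around `0`, through which the light-cone pole of `A^N_1` passes.
[cite: FederbushWilliamson1987PhaseCellII, Theorem 3.1 (3.2) p. 1417] -/
theorem not_theorem31 (s : ℕ) : ¬ Theorem31 s 0 := by
  rintro ⟨ε₀, hε₀, g, hg, hagree⟩
  set ρ := min ε₀ (1 / 2) with hρdef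
  have hρ : 0 < ρ := lt_min hε₀ (by norm_num)
  have hρ2 : ρ ≤ 1 / 2 := min_le_right _ _
  have hsub : ball (0 : Momentum) ρ ⊆ DL ε₀ := ball_subset_DL hρ hρ2 (min_le_left _ _)
  exact no_holomorphic_extension s hρ hρ2 ((hg.mono hsub).differentiableOn)
    (fun p hp _ => hagree p hp)

/-- **Theorem 3.2 is false as typed** (component `i = 1`, every `s`): `𝒟_G(ε₀) ⊇` the ball `‖p‖ < min(ε₀, 1/2)`.
[cite: FederbushWilliamson1987PhaseCellII, Theorem 3.2 (3.3) p. 1417] -/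
theorem not_theorem32 (s : ℕ) : ¬ Theorem32 s 0 := by
  rintro ⟨ε₀, hε₀, g, hg, hagree⟩
  set ρ := min ε₀ (1 / 2) with hρdef
  have hρ : 0 < ρ := lt_min hε₀ (by norm_num)
  have hρ2 : ρ ≤ 1 / 2 := min_le_right _ _
  have hsub : ball (0 : Momentum) ρ ⊆ DG ε₀ := ball_subset_DG hρ (min_le_left _ _)
  exact no_holomorphic_extension s hρ hρ2 ((hg.mono hsub).differentiableOn)
    (fun p hp _ => hagree p hp)

/-- **Theorem 3.3 is false as typed** (component `i = 1`, every `s`): it includes the analytic extension to `𝒟_G(ε₀)`.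
[cite: FederbushWilliamson1987PhaseCellII, Theorem 3.3 (3.4)–(3.5) p. 1417] -/
theorem not_theorem33 (s : ℕ) : ¬ Theorem33 s 0 := by
  rintro ⟨ε₀, hε₀, g, hg, hagree, -⟩
  exact not_theorem32 s ⟨ε₀, hε₀, g, hg, hagree⟩

/-- **The package «Theorems 3.1–3.3 for all large s and every component» is false as typed.**
[cite: FederbushWilliamson1987PhaseCellII, Theorems 3.1–3.3 p. 1417] -/
theorem not_theorems31to33 : ¬ Theorems31to33 := by
  intro h
  obtain ⟨s₀, hs⟩ := theorems_of_Theorems31to33 h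
  exact not_theorem31 s₀ (hs s₀ le_rfl 0).1

end ModeAnalyticityThm31Refutation

end Literature.MathematicalPhysics.QuantumFieldTheory.Federbush1986
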